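import Summits.HodgeConjecture.HodgeConjecture.Theses.DeltaPeriodAudit

/-!
# Route DeltaPeriodAudit — `DeltaImagAxisPos` (support item stmt-HodgeConjecture-2368)

`Δ(it) > 0` for `t > 0`: on the imaginary axis the Dedekind product is a product of reals —
`q^{1/24} = e^{-2πt/24}` and `1 - qⁿ⁺¹ = 1 - e^{-2π(n+1)t} ∈ (0, 1)` — so
`η(it) = e^{-2πt/24} ∏ (1 - e^{-2π(n+1)t})` is a positive real number (the real infinite product is
`exp` of the convergent sum of logarithms, `Real.rexp_tsum_eq_tprod`), and `Δ(it) = η(it)²⁴` is a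
positive real.  Mathlib's `ModularForm.discriminant = η ^ 24`, `ModularForm.eta`,
`Topology.IsClosedEmbedding.map_tprod` (the inclusion `ℝ ↪ ℂ` commutes with infinite products).  No
named-fact hypothesis, no sorry.
-/

-- `Summit.HodgeConjecture.HodgeConjecture.Theorems` is the mandated namespace (single-problem
-- summit: Problem = Summit), which `linter.dupNamespace` flags on every declaration; the lakefile
-- turns the linter off tree-wide (weak option), restated here so stand-alone elaboration is
-- warning-free too.
set_option linter.dupNamespace false

noncomputable section

namespace Summit.HodgeConjecture.HodgeConjecture.Theorems

open scoped Real

/-- **Item stmt-HodgeConjecture-2368 (`DeltaImagAxisPos`), route `DeltaPeriodAudit`**: `Δ(it)` is a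
positive real number for `t > 0` (product formula on the imaginary axis).
[cite: Shimura1977, §1] -/
theorem deltaPeriodAudit_deltaImagAxisPos_proof :
    Summit.HodgeConjecture.HodgeConjecture.Theses.DeltaPeriodAudit.DeltaImagAxisPos := by
  intro t ht
  set z : ℂ := (t : ℂ) * Complex.I with hz
  have hzim : 0 < z.im := by simp [hz, ht]
  have hcoe : ((UpperHalfPlane.ofComplex z : UpperHalfPlane) : ℂ) = z := by
    rw [UpperHalfPlane.ofComplex_apply_of_im_pos hzim]
  -- the real factors
  set r : ℕ → ℝ := fun n ↦ Real.exp (-(2 * π * (n + 1) * t)) with hr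
  have hr_pos : ∀ n, 0 < r n := fun n ↦ Real.exp_pos _
  have hr_lt : ∀ n, r n < 1 := fun n ↦ Real.exp_lt_one_iff.2 (by
    have : (0 : ℝ) < 2 * π * (n + 1) * t := by positivity
    linarith)
  have hq : ∀ n : ℕ, ModularForm.eta_q n z = (r n : ℂ) := by
    intro n
    rw [ModularForm.eta_q_eq_cexp, hr]
    dsimp only
    rw [Complex.ofReal_exp]
    congr 1
    rw [hz]
    push_cast
    ring_nf
    rw [Complex.I_sq]
    ring
  -- the complex product is the (image of the) real product
  have hce : Topology.IsClosedEmbedding (Complex.ofRealHom : ℝ → ℂ) :=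
    Complex.isometry_ofReal.isClosedEmbedding
  have hprod : ∏' n, (1 - ModularForm.eta_q n z) = ((∏' n, (1 - r n) : ℝ) : ℂ) := by
    calc ∏' n, (1 - ModularForm.eta_q n z) = ∏' n, Complex.ofRealHom (1 - r n) :=
          tprod_congr fun n ↦ by rw [hq]; simp
      _ = Complex.ofRealHom (∏' n, (1 - r n)) := (hce.map_tprod _).symm
      _ = _ := rfl
  -- the real product is positive
  have hP : 0 < ∏' n, (1 - r n) := by
    have hgeom : Summable fun n : ℕ ↦ ‖(-r n)‖ := by
      have h1 : Real.exp (-(2 * π * t)) < 1 := Real.exp_lt_one_iff.2 (by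
        have : (0 : ℝ) < 2 * π * t := by positivity
        linarith)
      have h := (summable_nat_add_iff 1).2
        (summable_geometric_of_lt_one (Real.exp_pos _).le h1)
      refine h.congr fun n ↦ ?_
      rw [norm_neg, Real.norm_of_nonneg (hr_pos n).le, hr]
      dsimp only
      rw [← Real.exp_nat_mul]
      congr 1
      push_cast
      ring
    have hpos : ∀ n, 0 < 1 - r n := fun n ↦ sub_pos.2 (hr_lt n)
    have hlog : Summable fun n ↦ Real.log (1 - r n) := by
      refine hgeom.summable_log_norm_one_add.congr fun n ↦ ?_
      rw [← sub_eq_add_neg, Real.norm_of_nonneg (hpos n).le]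
    rw [← Real.rexp_tsum_eq_tprod hpos hlog]
    exact Real.exp_pos _
  -- the `q^{1/24}` factor
  have hq24 : Function.Periodic.qParam 24 z = ((Real.exp (-(2 * π * t / 24)) : ℝ) : ℂ) := by
    rw [Function.Periodic.qParam, Complex.ofReal_exp]
    congr 1
    rw [hz]
    push_cast
    ring_nf
    rw [Complex.I_sq]
    ring
  -- assemble
  have heta : ModularForm.eta z = ((Real.exp (-(2 * π * t / 24)) * ∏' n, (1 - r n) : ℝ) : ℂ) := by
    rw [ModularForm.eta, hq24, hprod, Complex.ofReal_mul]
  have hΔ : ModularForm.discriminant (UpperHalfPlane.ofComplex z) =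
      (((Real.exp (-(2 * π * t / 24)) * ∏' n, (1 - r n)) ^ 24 : ℝ) : ℂ) := by
    rw [ModularForm.discriminant, hcoe, heta, Complex.ofReal_pow]
  rw [hΔ, Complex.ofReal_re, Complex.ofReal_im]
  exact ⟨pow_pos (mul_pos (Real.exp_pos _) hP) 24, rfl⟩

end Summit.HodgeConjecture.HodgeConjecture.Theorems

end
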